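import Summits.Ventures.YMGap.RobustBall.TorusOneLink
import Literature.MathematicalPhysics.QuantumFieldTheory.QuasiLocalGaugePerturbationKernels
import HarnessLib

/-!
# Venture YMGap, track ROBUST-BALL (Y2) — THE FINITE-VOLUME FREE ENERGY IS 2-LIPSCHITZ ACROSS THE BALL IN THE KOTECKÝ–PREISS / BAŁABAN NORM,
# uniformly in the volume and in the coupling

HONEST FRAMING. WHAT THIS IS: a venture file (cell `pub-ymgap`, track Y2 ROBUST-BALL, seat rb-p2, theorems only, 0 compute).  Finite-volume
(torus) LATTICE statements for ANY two quasi-local gauge-invariant perturbations `W, W'` of the `SU(N)` Wilson action (`Perturbation d L N`)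
which are `δ`-close in lit's weighted norm, `‖W − W'‖_{1,κ} ≤ δ` (`QuasiLocalGaugePerturbation.NormLE κ δ`, `κ ≥ 0`: every weighted sum
`Σ_{X ∋ y} e^{κ|X|} ‖(W − W')_X‖_∞` through a site is `≤ δ` — the Banach norm of the cell's «ClusterDomain» language):
* `abs_total_sub_total_sub_le` — `W.total − W'.total` is within `δ · L^d` of a constant (lit's `exists_abs_total_glueWith_sub_le` on the full
  torus; the constant is the activity of the empty polymer, invisible to the norm and to the physics).
* `abs_log_partitionFunction_sub_le` — `|log Z_{Λ,t,W} − log Z_{Λ,t,W'} + c| ≤ δ L^d` with ONE constant `c` for all couplings `t`.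
* ★★ `abs_normalizedPressure_sub_le` — THE NORMALIZED PRESSURES ARE `2δ`-CLOSE: for every torus side `L` and every coupling `t`,
  `|(p_{L,W}(t) − p_{L,W}(0)) − (p_{L,W'}(t) − p_{L,W'}(0))| ≤ 2δ`, `p_{L,W}(t) = L^{−d} log Z_{Λ_L,t,W}` — the finite-volume free energy (normalised at
  `t = 0`, which removes the constant energy shifts the norm does not see) is 2-Lipschitz across the ball, uniformly in `L` and `t`.
* ★★ `abs_limit_sub_le_of_tendsto` — consequently any two pointwise limits `f, f'` of such pressures along the same volumes (members `W_n, W'_n`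
  with `‖W_n − W'_n‖ ≤ δ`) satisfy `|(f t − f 0) − (f' t − f' 0)| ≤ 2δ`: whatever infinite-volume free energy the members have is Lipschitz in the
  Banach norm of the ball.
WHAT THIS IS NOT: no existence claim for member free energies; the estimate is the elementary `|log ∫e^{−A} − log ∫e^{−A'}| ≤ ‖A − A'‖_∞`, not a
cluster expansion; nothing about the continuum limit or a Clay-sense mass gap.

References: S. Friedli, Y. Velenik (2017), §5 (the Kotecký–Preiss norm); T. Bałaban, CMP 119 (1988) p. 259; the tree's
`QuasiLocalGaugePerturbationLocality.lean` / `…Kernels.lean`.  Everything here is proved; no definition, no named fact. [folklore]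
-/

noncomputable section

open MeasureTheory ProbabilityTheory Finset Function Filter Topology
open Literature.Probability.LatticeModels (glueWith glueWith_apply_mem)
open Literature.MathematicalPhysics.QuantumLattice hiding torusNorm
open Literature.MathematicalPhysics.QuantumFieldTheory hiding ZdEdge Site

namespace Summit.Ventures.YMGap.RobustBall

namespace EnergyVariance

variable {d L N : ℕ} [NeZero L] (ρ : SUN N →* Matrix (Fin N) (Fin N) ℂ)

/-- At block scale `1` every site is a block corner: `#blockCorners 1 = L^d`. [folklore] -/
theorem card_blockCorners_one : (blockCorners (d := d) (L := L) 1).card = L ^ d := by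
  classical
  have h : blockCorners (d := d) (L := L) 1 = Finset.univ := by
    ext y
    simp only [Finset.mem_univ, iff_true]
    exact mem_blockCorners_iff.2 fun _ => one_dvd _
  rw [h, Finset.card_univ, Fintype.card_fun, ZMod.card, Fintype.card_fin]

/-- **Norm-close perturbations differ by a near-constant**: `‖W − W'‖_{1,κ} ≤ δ` (`κ ≥ 0`) ⇒ there is `c` with
`|W.total U − W'.total U − c| ≤ δ · L^d` for every configuration `U`. [folklore] -/
theorem abs_total_sub_total_sub_le {W W' : Perturbation d L N} {κ δ : ℝ} (hκ : 0 ≤ κ) (hWW' : (W - W').NormLE κ δ) :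
    ∃ c : ℝ, ∀ U : GaugeConfig d L (SUN N), |W.total U - W'.total U - c| ≤ δ * (L : ℝ) ^ d := by
  classical
  obtain ⟨c, hc⟩ := QuasiLocalGaugePerturbation.exists_abs_total_glueWith_sub_le (W - W') hκ hWW' (R := blockCorners 1)
    subset_rfl (Λ := Finset.univ) (fun e _ => by rw [blockCorner_one]; exact mem_blockCorners_iff.2 fun _ => one_dvd _)
    (1 : GaugeConfig d L (SUN N))
  refine ⟨c, fun U => ?_⟩
  have hU : glueWith (Finset.univ : Finset (Edge d L)) (fun e : ↥(Finset.univ : Finset (Edge d L)) => U e.1)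
      (1 : GaugeConfig d L (SUN N)) = U := by
    funext e
    rw [glueWith_apply_mem _ _ _ (Finset.mem_univ e)]
  have h := hc fun e : ↥(Finset.univ : Finset (Edge d L)) => U e.1
  rw [hU, card_blockCorners_one] at h
  have hsub : (W - W').total U = W.total U - W'.total U := by
    simp only [QuasiLocalGaugePerturbation.total, QuasiLocalGaugePerturbation.sub_act, Finset.sum_sub_distrib]
  rw [hsub] at h
  exact_mod_cast h

/-- **The log-partition functions of norm-close members differ by a near-constant, uniformly in the coupling**:
`|log Z_{Λ,t,W} − log Z_{Λ,t,W'} + c| ≤ δ L^d` for all `t`, with the constant `c` of `abs_total_sub_total_sub_le`. [folklore] -/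
theorem abs_log_partitionFunction_sub_le (hρ : Continuous ρ) {W W' : Perturbation d L N} {κ δ : ℝ} (hκ : 0 ≤ κ)
    (hWW' : (W - W').NormLE κ δ) :
    ∃ c : ℝ, ∀ t : ℝ, |Real.log (W.partitionFunction ρ t).toReal - Real.log (W'.partitionFunction ρ t).toReal + c| ≤ δ * (L : ℝ) ^ d := by
  haveI : SecondCountableTopology (Matrix (Fin N) (Fin N) ℂ) :=
    inferInstanceAs (SecondCountableTopology (Fin N → Fin N → ℂ))
  haveI : SecondCountableTopology (SUN N) := Topology.IsEmbedding.subtypeVal.secondCountableTopology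
  obtain ⟨c, hc⟩ := abs_total_sub_total_sub_le (W := W) (W' := W') hκ hWW'
  refine ⟨c, fun t => ?_⟩
  set π : Measure (GaugeConfig d L (SUN N)) := Measure.pi fun _ : Edge d L => haarProbability (SUN N) with hπ
  set D : ℝ := δ * (L : ℝ) ^ d with hD
  have hI : ∀ V : Perturbation d L N, Integrable (fun U => Real.exp (-t * wilsonAction ρ U - V.total U)) π := fun V =>
    Literature.Probability.LatticeModels.integrable_exp_of_abs_le _
      (QuasiLocalGaugePerturbation.measurable_action ρ hρ t V) (QuasiLocalGaugePerturbation.exists_abs_action_le ρ hρ t V)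
  have hpos : ∀ V : Perturbation d L N, 0 < ∫ U, Real.exp (-t * wilsonAction ρ U - V.total U) ∂π := fun V => integral_exp_pos (hI V)
  have hZ : ∀ V : Perturbation d L N, (V.partitionFunction ρ t).toReal = ∫ U, Real.exp (-t * wilsonAction ρ U - V.total U) ∂π := by
    intro V
    have e : V.partitionFunction ρ t = ENNReal.ofReal (∫ U, Real.exp (-t * wilsonAction ρ U - V.total U) ∂π) := by
      rw [ofReal_integral_eq_lintegral_ofReal (hI V) (ae_of_all _ fun U => (Real.exp_pos _).le)]
      simp only [QuasiLocalGaugePerturbation.partitionFunction, QuasiLocalGaugePerturbation.weight,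
        withDensity_apply _ MeasurableSet.univ, Measure.restrict_univ, hπ]
    rw [e, ENNReal.toReal_ofReal (hpos V).le]
  rw [hZ W, hZ W']
  -- pointwise: `e^{−tS − W} ≤ e^{−c + D} e^{−tS − W'}` and `e^{−tS − W'} ≤ e^{c + D} e^{−tS − W}`
  have h1 : ∫ U, Real.exp (-t * wilsonAction ρ U - W.total U) ∂π ≤
      Real.exp (-c + D) * ∫ U, Real.exp (-t * wilsonAction ρ U - W'.total U) ∂π := by
    rw [← integral_const_mul]
    refine integral_mono (hI W) ((hI W').const_mul _) fun U => ?_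
    have hU := hc U
    rw [← Real.exp_add]
    refine Real.exp_le_exp.2 ?_
    have := (abs_le.1 hU).1
    linarith
  have h2 : ∫ U, Real.exp (-t * wilsonAction ρ U - W'.total U) ∂π ≤
      Real.exp (c + D) * ∫ U, Real.exp (-t * wilsonAction ρ U - W.total U) ∂π := by
    rw [← integral_const_mul]
    refine integral_mono (hI W') ((hI W).const_mul _) fun U => ?_
    have hU := hc U
    rw [← Real.exp_add]
    refine Real.exp_le_exp.2 ?_
    have := (abs_le.1 hU).2
    linarith
  have l1 := Real.log_le_log (hpos W) h1
  have l2 := Real.log_le_log (hpos W') h2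
  rw [Real.log_mul (Real.exp_pos _).ne' (hpos W').ne', Real.log_exp] at l1
  rw [Real.log_mul (Real.exp_pos _).ne' (hpos W).ne', Real.log_exp] at l2
  rw [abs_le]
  constructor <;> linarith

/-- ★★ **THE NORMALIZED FINITE-VOLUME FREE ENERGY IS 2-LIPSCHITZ ACROSS THE BALL IN THE WEIGHTED NORM, uniformly in the volume and the
coupling**: `‖W − W'‖_{1,κ} ≤ δ` (`κ ≥ 0`) ⇒ for every `t`,
`|(p_{L,W}(t) − p_{L,W}(0)) − (p_{L,W'}(t) − p_{L,W'}(0))| ≤ 2δ`, `p_{L,W}(t) = L^{−d} log Z_{Λ_L,t,W}`. [folklore] -/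
theorem abs_normalizedPressure_sub_le (hρ : Continuous ρ) {W W' : Perturbation d L N} {κ δ : ℝ} (hκ : 0 ≤ κ)
    (hWW' : (W - W').NormLE κ δ) (t : ℝ) :
    |(((L : ℝ) ^ d)⁻¹ * Real.log (W.partitionFunction ρ t).toReal - ((L : ℝ) ^ d)⁻¹ * Real.log (W.partitionFunction ρ 0).toReal) -
        (((L : ℝ) ^ d)⁻¹ * Real.log (W'.partitionFunction ρ t).toReal - ((L : ℝ) ^ d)⁻¹ * Real.log (W'.partitionFunction ρ 0).toReal)| ≤
      2 * δ := by
  obtain ⟨c, hc⟩ := abs_log_partitionFunction_sub_le ρ hρ (W := W) (W' := W') hκ hWW'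
  have hL0 : (0 : ℝ) < (L : ℝ) ^ d := by
    have : (0 : ℝ) < L := by exact_mod_cast Nat.pos_of_ne_zero (NeZero.ne L)
    positivity
  have ht := hc t
  have h0 := hc 0
  -- `|(a_t − a'_t) − (a_0 − a'_0)| ≤ |a_t − a'_t + c| + |a_0 − a'_0 + c| ≤ 2 δ L^d`
  have key : |(Real.log (W.partitionFunction ρ t).toReal - Real.log (W'.partitionFunction ρ t).toReal) -
      (Real.log (W.partitionFunction ρ 0).toReal - Real.log (W'.partitionFunction ρ 0).toReal)| ≤ 2 * (δ * (L : ℝ) ^ d) := by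
    have e : (Real.log (W.partitionFunction ρ t).toReal - Real.log (W'.partitionFunction ρ t).toReal) -
        (Real.log (W.partitionFunction ρ 0).toReal - Real.log (W'.partitionFunction ρ 0).toReal) =
        (Real.log (W.partitionFunction ρ t).toReal - Real.log (W'.partitionFunction ρ t).toReal + c) -
          (Real.log (W.partitionFunction ρ 0).toReal - Real.log (W'.partitionFunction ρ 0).toReal + c) := by ring
    rw [e]
    exact (abs_sub _ _).trans (by linarith)
  have e2 : (((L : ℝ) ^ d)⁻¹ * Real.log (W.partitionFunction ρ t).toReal - ((L : ℝ) ^ d)⁻¹ * Real.log (W.partitionFunction ρ 0).toReal) -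
      (((L : ℝ) ^ d)⁻¹ * Real.log (W'.partitionFunction ρ t).toReal - ((L : ℝ) ^ d)⁻¹ * Real.log (W'.partitionFunction ρ 0).toReal) =
      ((L : ℝ) ^ d)⁻¹ * ((Real.log (W.partitionFunction ρ t).toReal - Real.log (W'.partitionFunction ρ t).toReal) -
        (Real.log (W.partitionFunction ρ 0).toReal - Real.log (W'.partitionFunction ρ 0).toReal)) := by ring
  rw [e2, abs_mul, abs_of_pos (inv_pos.2 hL0)]
  calc ((L : ℝ) ^ d)⁻¹ * |(Real.log (W.partitionFunction ρ t).toReal - Real.log (W'.partitionFunction ρ t).toReal) -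
        (Real.log (W.partitionFunction ρ 0).toReal - Real.log (W'.partitionFunction ρ 0).toReal)|
      ≤ ((L : ℝ) ^ d)⁻¹ * (2 * (δ * (L : ℝ) ^ d)) := mul_le_mul_of_nonneg_left key (inv_pos.2 hL0).le
    _ = 2 * δ := by field_simp

/-- ★★ **EVERY THERMODYNAMIC LIMIT OF MEMBER FREE ENERGIES IS LIPSCHITZ IN THE WEIGHTED NORM.**  Let `W_n, W'_n` be perturbations on tori of
sides `L_n` with `‖W_n − W'_n‖_{1,κ} ≤ δ` for all `n`, and suppose their pressures converge pointwise at `t` and at `0` to `f t, f 0` resp.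
`f' t, f' 0`.  Then `|(f t − f 0) − (f' t − f' 0)| ≤ 2δ`. [folklore] -/
theorem abs_limit_sub_le_of_tendsto {Ls : ℕ → ℕ} [∀ n, NeZero (Ls n)] {Ws Ws' : (n : ℕ) → Perturbation d (Ls n) N} {κ δ : ℝ}
    (hκ : 0 ≤ κ) (hWW' : ∀ n, (Ws n - Ws' n).NormLE κ δ) {f f' : ℝ → ℝ} {t : ℝ}
    (hf : ∀ s ∈ ({0, t} : Set ℝ), Tendsto (fun n => (((Ls n) : ℝ) ^ d)⁻¹ *
      Real.log ((Ws n).partitionFunction (fundamentalRep (Fin N)) s).toReal) atTop (𝓝 (f s)))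
    (hf' : ∀ s ∈ ({0, t} : Set ℝ), Tendsto (fun n => (((Ls n) : ℝ) ^ d)⁻¹ *
      Real.log ((Ws' n).partitionFunction (fundamentalRep (Fin N)) s).toReal) atTop (𝓝 (f' s))) :
    |(f t - f 0) - (f' t - f' 0)| ≤ 2 * δ := by
  have hρc : Continuous (fundamentalRep (Fin N) : SUN N →* Matrix (Fin N) (Fin N) ℂ) := continuous_fundamentalRep (Fin N)
  have hlim : Tendsto (fun n =>
      ((((Ls n) : ℝ) ^ d)⁻¹ * Real.log ((Ws n).partitionFunction (fundamentalRep (Fin N)) t).toReal -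
        (((Ls n) : ℝ) ^ d)⁻¹ * Real.log ((Ws n).partitionFunction (fundamentalRep (Fin N)) 0).toReal) -
      ((((Ls n) : ℝ) ^ d)⁻¹ * Real.log ((Ws' n).partitionFunction (fundamentalRep (Fin N)) t).toReal -
        (((Ls n) : ℝ) ^ d)⁻¹ * Real.log ((Ws' n).partitionFunction (fundamentalRep (Fin N)) 0).toReal))
      atTop (𝓝 ((f t - f 0) - (f' t - f' 0))) :=
    ((hf t (by simp)).sub (hf 0 (by simp))).sub ((hf' t (by simp)).sub (hf' 0 (by simp)))
  refine le_of_tendsto ((continuous_abs.tendsto _).comp hlim) (Filter.Eventually.of_forall fun n => ?_)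
  exact abs_normalizedPressure_sub_le (fundamentalRep (Fin N)) hρc hκ (hWW' n) t

end EnergyVariance

end Summit.Ventures.YMGap.RobustBall
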